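import Literature.Barriers.CriticalPhenomena.RigorousRGSmallParameterKatoResolvent
import Literature.Barriers.CriticalPhenomena.RigorousRGSmallParameterTorusResolvent
import Literature.Barriers.CriticalPhenomena.RigorousRGSmallParameterHeatKernel
import HarnessLib

/-!
# `RigorousRGSmallParameter` (Slade, Theorem 1.4.1): the Fourier-integral resolvents (2.12)–(2.13)
# ARE the resolvents — Proposition 2.1.3 for the operator kernels on `ℤ^d` and on the torus (3.6)

Companion of `RigorousRGSmallParameterKatoResolvent.lean` (Proposition 2.1.3 for the Fourier kernels
(2.12)–(2.13)) and `RigorousRGSmallParameterTorusResolvent.lean` (the resolvent `((-Δ)^β+m²)⁻¹` of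
`ℤ^d` as an inverse matrix, Lemma 2.2.2, (2.19)) in the proof architecture of the barrier
`RigorousRGSmallParameter.lean` (Slade's Theorem 1.4.1). Source: G. Slade, *Critical exponents for
long-range `O(n)` models below the upper critical dimension*, CMP 358 (2018), arXiv:1611.06169,
§2.1–§2.2 and §3.1–§3.2.

## What is at stake

§2.1.2 *defines* "the resolvent of `-Δ`" and "the resolvent of `(-Δ)^β`" by the Fourier integrals
(2.12) `(-Δ+m²)⁻¹_{0,x} = (2π)^{-d}∫e^{ik·x}/(λ(k)+m²)dk` and (2.13)
`((-Δ)^β+m²)⁻¹_{0,x} = (2π)^{-d}∫e^{ik·x}/(λ(k)^β+m²)dk`, and then uses them as inverse matrices: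
in Lemma 2.2.2 / (2.19) (the torus covariance `C = ((-Δ_Λ)^{α/2}+m²)⁻¹` of the model is the
periodisation of the `ℤ^d` resolvent), in (2.14) (`((-Δ)^β+m²)⁻¹𝟙 = m⁻²𝟙`), and in §3.1–§3.2,
where Proposition 2.1.3 is transported to the torus as (3.6)
`C_{0,x} = ∫₀^∞ (-Δ_Λ+s)⁻¹_{0,x} ρ^{(α/2)}(s,m²) ds` — the formula into which the finite-range
decomposition of the Laplacian resolvent is inserted. The tree so far had the two sides
separately: Proposition 2.1.3 for the Fourier kernels (`Slade2017_prop213`), and the inverse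
matrices by Neumann series (`fracResolventZd`, `Slade2017_torusResolvent`). This file identifies
them ("There are various equivalent ways to define the matrix `(-Δ)^β`", §2.1.1, carried over to
the resolvents), so that Proposition 2.1.3 becomes a statement about the covariance of the model.

## What this file proves (everything; no definition and no named fact is introduced)

* `hasSum_srwLaw_mul_cos` — `Σ_x pₙ(x)cos(k·x) = μ(k)ⁿ` for every `k` (`μ(k) = d⁻¹Σ_j cos k_j`
  the symbol of `D = J/2d`): the Fourier series of the `n`-step law.
* `hasSum_fracLaplacianZd_mul_cos` — **Fourier inversion for `(-Δ)^β`**: for a.e. `k`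
  (off the corners `|μ(k)| = 1`), `Σ_y ((-Δ)^β)_{0,y}cos(k·y) = λ(k)^β` (`0 < β < 1`, `d ≥ 1`),
  from the entrywise Taylor expansion (2.5) and the binomial series, all sums absolutely convergent;
  `fracLaplacianZd_one`, `hasSum_fracLaplacianZd_one_mul_cos` — the case `β = 1`:
  `-Δ_{x,y} = 2d(δ_{x,y} - p₁(x-y))` ((2.1)) with symbol `λ(k)` for every `k`.
* `hasSum_kernel_mul_fourierIntegral`, `hasSum_kernel_add_mass_mul_fourierResolvent` — the
  Fourier multiplier lemma for even summable kernels on `ℤ^d` (dominated convergence), and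
  `hasSum_inverse_mul_of_mul_eq` — uniqueness of the bounded inverse (`S(TF) = (ST)F`).
* **`fracResolventFourier_eq_fracResolventZd`** — for `d ≥ 1`, `0 < β < 1`, `m² > 0`: the Fourier
  kernel (2.13) equals the inverse matrix `((-Δ)^β+m²)⁻¹` on `ℓ^∞(ℤ^d)`
  (`hasSum_fracLaplacianZd_add_mass_mul_fourier`: it is a bounded right inverse).
* **`hasSum_resolventZd_series`** — the random-walk representation of (2.12),
  `(-Δ+s)⁻¹_{x,y} = Σ_n (2d)ⁿ(2d+s)^{-n-1}pₙ(x-y)` (`s > 0`); hence `resolventZd_nonneg`,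
  `hasSum_resolventZd_row` (`(-Δ+s)⁻¹𝟙 = s⁻¹𝟙`), `summable_abs_resolventZd`, and
  `hasSum_laplacianZd_add_mass_mul_resolvent` / `hasSum_resolvent_mul_laplacianZd_add_mass`:
  (2.12) is the two-sided inverse matrix of `-Δ + s`.
* **`Slade2017_torusLaplaceResolvent`** — display (3.2) for the operator: on the torus
  `Λ = (ℤ/Mℤ)^d` (any `M ≥ 1`), `(-Δ_Λ+s)⁻¹ = (covInvMatrix d 1 M s)⁻¹` is the periodisation of
  (2.12) (Lemma 2.2.2 with `T = -Δ + s`).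
* **`Slade2017_prop213_resolvent`** — Proposition 2.1.3 (massive case) for the operator kernels:
  `((-Δ)^β+m²)⁻¹_{x,y} = ∫₀^∞(-Δ+s)⁻¹_{x,y}ρ^{(β)}(s,m²)ds` with both sides inverse matrices;
  `Slade2017_resolvent_rowSum`, `Slade2017_display214`, `integral_inv_mul_katoDensity` — display
  (2.14) `((-Δ)^β+m²)⁻¹𝟙 = ∫₀^∞(-Δ+s)⁻¹𝟙ρds = ∫₀^∞s⁻¹𝟙ρds = m⁻²𝟙`;
  `Slade2017_display219_fourier` — (2.19) with the Fourier kernel (2.13) as printed.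
* **`Slade2017_torusCovariance_katoMixture`** — display (3.6), PROVED: for `d ≥ 1`, `0 < β < 1`,
  `m² > 0`, any period `M ≥ 1` and all `x, y ∈ Λ`,
  `((-Δ_Λ)^β+m²)⁻¹_{x,y} = ∫₀^∞ (-Δ_Λ+s)⁻¹_{x,y} ρ^{(β)}(s,m²) ds`, the interchange of the
  periodisation sum and the `s`-integral being justified by positivity (`integral_tsum`).

Ledger effect: none on the trust base of the barrier's reduction chain (`Slade2017_prop822`
remains the named fact); this closes the `ℤ^d`/torus operator side of §2.1–§3.2 up to (3.6). Not
treated: the massless identification (`m² = 0`, `d > 2β`, where `((-Δ)^β)⁻¹` is not a bounded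
operator on `ℓ^∞`), the finite-range decomposition `(-Δ+s)⁻¹ = Σ_jΓ_j` of [Baue13a] (§3.1) and
Proposition 3.3.1.
-/

noncomputable section

namespace Literature.Barriers.CriticalPhenomena

open _root_.MeasureTheory Set Filter
open scoped _root_.Topology Real

namespace LongRangePhi4

open Literature.Probability.LatticeModels

variable {d : ℕ}

/-! ### The phase `k·x` (`phase_neg` is in `RigorousRGSmallParameterHeatKernel`) -/

/-- The phase of the kernels of the barrier file: `Σ_j k_j (x_j - y_j) = k·(x-y)`. [folklore] -/
theorem sum_mul_sub_eq_phase (k : Fin d → ℝ) (x y : Site d) :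
    (∑ j, k j * ((x j : ℝ) - (y j : ℝ))) = phase k (x - y) := by
  unfold phase
  refine Finset.sum_congr rfl fun j _ => ?_
  rw [Pi.sub_apply, Int.cast_sub]

/-- A summable nonnegative family times a family bounded by `1` is summable. [folklore] -/
theorem summable_mul_of_abs_le_one {ι : Type*} {f g : ι → ℝ} (hf : Summable f)
    (hf0 : ∀ i, 0 ≤ f i) (hg : ∀ i, |g i| ≤ 1) : Summable fun i => f i * g i :=
  Summable.of_norm_bounded hf fun i => by
    rw [Real.norm_eq_abs, abs_mul, abs_of_nonneg (hf0 i)]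
    exact mul_le_of_le_one_right (hf0 i) (hg i)

/-! ### Fourier series of the `n`-step law: `Σ_x pₙ(x) cos(k·x) = μ(k)ⁿ` -/

/-- **The characteristic function of the `n`-step law of simple random walk**:
`Σ_{x∈ℤ^d} pₙ(x) cos(k·x) = μ(k)ⁿ`, `μ(k) = d⁻¹Σ_j cos k_j` (the Fourier-series side of
"`(Dⁿ)_{x,y}` are the `n`-step transition probabilities", §2.1.1), by induction on `n` from the
recursion defining `pₙ` and `cos(a-b) + cos(a+b) = 2 cos a cos b`; every `k`, no exceptional set.
[cite: Slade2017, §2.1.1 (Taylor expansion: the matrix D = J/2d)] -/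
theorem hasSum_srwLaw_mul_cos (hd : 1 ≤ d) (k : Fin d → ℝ) (n : ℕ) :
    HasSum (fun x : Site d => srwLaw d n x * Real.cos (phase k x)) (avgCos d k ^ n) := by
  have hd' : (0 : ℝ) < d := by exact_mod_cast hd
  induction n with
  | zero =>
    have h0 : (fun x : Site d => srwLaw d 0 x * Real.cos (phase k x)) =
        fun x => if x = 0 then (1 : ℝ) else 0 := by
      funext x
      rw [srwLaw_zero_apply]
      split_ifs with h
      · subst h
        simp [phase]
      · rw [zero_mul]
    rw [h0, pow_zero]
    exact hasSum_ite_eq (0 : Site d) (1 : ℝ)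
  | succ n ih =>
    have hsum : ∀ j : Fin d, HasSum (fun x : Site d =>
        (srwLaw d n (x + Pi.single j 1) + srwLaw d n (x - Pi.single j 1)) * Real.cos (phase k x))
        (2 * Real.cos (k j) * avgCos d k ^ n) := by
      intro j
      set e : Site d := Pi.single j 1 with he
      have hs1 : Summable fun w : Site d => srwLaw d n w * Real.cos (phase k (w - e)) :=
        summable_mul_of_abs_le_one (hasSum_srwLaw hd n).summable (srwLaw_nonneg n)
          fun w => Real.abs_cos_le_one _
      have hs2 : Summable fun w : Site d => srwLaw d n w * Real.cos (phase k (w + e)) :=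
        summable_mul_of_abs_le_one (hasSum_srwLaw hd n).summable (srwLaw_nonneg n)
          fun w => Real.abs_cos_le_one _
      have h1 : HasSum (fun x : Site d => srwLaw d n (x + e) * Real.cos (phase k x))
          (∑' w, srwLaw d n w * Real.cos (phase k (w - e))) := by
        have h := ((Equiv.addRight e).hasSum_iff
          (f := fun w : Site d => srwLaw d n w * Real.cos (phase k (w - e)))).2 hs1.hasSum
        refine h.congr_fun fun x => ?_
        simp only [Function.comp_apply, Equiv.coe_addRight, add_sub_cancel_right]
      have h2 : HasSum (fun x : Site d => srwLaw d n (x - e) * Real.cos (phase k x))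
          (∑' w, srwLaw d n w * Real.cos (phase k (w + e))) := by
        have h := ((Equiv.subRight e).hasSum_iff
          (f := fun w : Site d => srwLaw d n w * Real.cos (phase k (w + e)))).2 hs2.hasSum
        refine h.congr_fun fun x => ?_
        simp only [Function.comp_apply, Equiv.subRight_apply, sub_add_cancel]
      have h12 : (∑' w, srwLaw d n w * Real.cos (phase k (w - e))) +
          (∑' w, srwLaw d n w * Real.cos (phase k (w + e))) =
            2 * Real.cos (k j) * avgCos d k ^ n := by
        rw [← (hs1.hasSum.add hs2.hasSum).tsum_eq]
        have hpt : ∀ w : Site d, srwLaw d n w * Real.cos (phase k (w - e)) +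
            srwLaw d n w * Real.cos (phase k (w + e)) =
              2 * Real.cos (k j) * (srwLaw d n w * Real.cos (phase k w)) := by
          intro w
          rw [he, phase_sub_single, phase_add_single, Real.cos_sub, Real.cos_add]
          ring
        simp_rw [hpt]
        rw [tsum_mul_left, ih.tsum_eq]
      rw [← h12]
      refine (h1.add h2).congr_fun fun x => ?_
      ring
    have htot := (hasSum_sum fun j (_ : j ∈ Finset.univ) => hsum j).div_const (2 * (d : ℝ))
    have e : (∑ j ∈ Finset.univ, 2 * Real.cos (k j) * avgCos d k ^ n) / (2 * d) =
        avgCos d k ^ (n + 1) := by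
      rw [← Finset.sum_mul, ← Finset.mul_sum, pow_succ, avgCos]
      field_simp
    rw [e] at htot
    refine htot.congr_fun fun x => ?_
    rw [srwLaw_succ_apply, div_mul_eq_mul_div, Finset.sum_mul]

/-- Reflected form: `Σ_y pₙ(0 - y) cos(k·y) = μ(k)ⁿ` (the row of `Dⁿ` through the origin as it
enters `hasSum_fracLaplacianZd`). [cite: Slade2017, §2.1.1 (Taylor expansion)] -/
theorem hasSum_srwLaw_zero_sub_mul_cos (hd : 1 ≤ d) (k : Fin d → ℝ) (n : ℕ) :
    HasSum (fun y : Site d => srwLaw d n (0 - y) * Real.cos (phase k y)) (avgCos d k ^ n) := by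
  have h := ((Equiv.neg (Site d)).hasSum_iff
    (f := fun x : Site d => srwLaw d n x * Real.cos (phase k x))).2 (hasSum_srwLaw_mul_cos hd k n)
  refine h.congr_fun fun y => ?_
  simp only [Function.comp_apply, Equiv.neg_apply, zero_sub, phase_neg, Real.cos_neg]

/-! ### Fourier inversion for `(-Δ)^β`: `Σ_y ((-Δ)^β)_{0,y} cos(k·y) = λ(k)^β` -/

/-- **Fourier inversion for the fractional Laplacian.** For `d ≥ 1`, `0 < β < 1` and every `k`
off the corner set `|μ(k)| = 1` (a Lebesgue-null set, `abs_avgCos_lt_one_ae`), the absolutely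
summable row `((-Δ)^β)_{0,·}` has Fourier series `Σ_y ((-Δ)^β)_{0,y} cos(k·y) = λ(k)^β` — i.e. the
"Fourier transform" definition (2.4) and the "Taylor expansion" (2.5) of §2.1.1 describe the same
matrix also in the sense that `λ^β` is recovered as the symbol of the matrix: from (2.5) entrywise
(`hasSum_fracLaplacianZd`), `Σ_y pₙ(-y)cos(k·y) = μ(k)ⁿ` and the binomial series
`(2d)^β Σ_n a_n μ(k)ⁿ = (2d)^β(1-μ(k))^β = λ(k)^β`, the double series converging absolutely
(`Σ_n |a_n| < ∞`). [cite: Slade2017, §2.1.1 ("There are various equivalent ways to define (-Δ)^β": (2.4) and (2.5))] -/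
theorem hasSum_fracLaplacianZd_mul_cos (hd : 1 ≤ d) {β : ℝ} (hβ0 : 0 < β) (hβ1 : β < 1)
    {k : Fin d → ℝ} (hk : |avgCos d k| < 1) :
    HasSum (fun y : Site d => fracLaplacianZd d β 0 y * Real.cos (phase k y))
      (laplaceSymbol k ^ β) := by
  have hd' : (0 : ℝ) < d := by exact_mod_cast hd
  have h2d : (0 : ℝ) ≤ 2 * d := by positivity
  set C : ℝ := (2 * d : ℝ) ^ β with hC
  have hC0 : 0 ≤ C := Real.rpow_nonneg h2d β
  set g : ℕ → Site d → ℝ := fun n y =>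
    C * binomAlt β n * srwLaw d n (0 - y) * Real.cos (phase k y) with hg
  set f : ℕ → Site d → ℝ := fun n y => C * |binomAlt β n| * srwLaw d n (0 - y) with hf
  have hfg : ∀ n y, |g n y| ≤ f n y := by
    intro n y
    simp only [hg, hf]
    rw [abs_mul, abs_mul, abs_mul, abs_of_nonneg hC0, abs_of_nonneg (srwLaw_nonneg _ _)]
    exact mul_le_of_le_one_right (mul_nonneg (mul_nonneg hC0 (abs_nonneg _)) (srwLaw_nonneg _ _))
      (Real.abs_cos_le_one _)
  have ha : ∀ n, HasSum (f n) (C * |binomAlt β n|) := by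
    intro n
    have h := ((Equiv.neg (Site d)).hasSum_iff (f := srwLaw d n)).2 (hasSum_srwLaw hd n)
    have h' : HasSum (fun y : Site d => srwLaw d n (0 - y)) 1 :=
      h.congr_fun fun y => by simp only [Function.comp_apply, Equiv.neg_apply, zero_sub]
    simpa only [hf, mul_one] using h'.mul_left (C * |binomAlt β n|)
  have hs : HasSum (fun n => C * |binomAlt β n|) (∑' n, C * |binomAlt β n|) :=
    ((summable_abs_binomAlt hβ0 hβ1).mul_left C).hasSum
  have hb : ∀ n, HasSum (g n) (C * binomAlt β n * avgCos d k ^ n) := by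
    intro n
    have h := (hasSum_srwLaw_zero_sub_mul_cos hd k n).mul_left (C * binomAlt β n)
    refine h.congr_fun fun y => ?_
    simp only [hg]
    ring
  have ht : HasSum (fun n => C * binomAlt β n * avgCos d k ^ n) (laplaceSymbol k ^ β) := by
    have h := (hasSum_binomAlt_mul_pow β hk).mul_left C
    have hlam : C * (1 - avgCos d k) ^ β = laplaceSymbol k ^ β := by
      rw [hC, laplaceSymbol_eq_avgCos hd, Real.mul_rpow h2d]
      linarith [abs_le.1 (abs_avgCos_le_one k)]
    rw [hlam] at h
    refine h.congr_fun fun n => ?_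
    ring
  obtain ⟨-, hswap⟩ := hasSum_swap_of_abs_le hfg ha hs hb ht
  refine hswap.congr_fun fun y => ?_
  exact (((hasSum_fracLaplacianZd hd hβ0 hβ1 0 y).mul_right (Real.cos (phase k y))).tsum_eq).symm

/-! ### The Laplacian itself (`β = 1`): `-Δ_{x,y} = 2d(δ_{x,y} - p₁(x-y))`, symbol `λ(k)` -/

/-- **The lattice Laplacian as the `β = 1` case of the Fourier definition**:
`(2π)^{-d}∫λ(k)cos(k·(x-y))dk = 2d(p₀(x-y) - p₁(x-y))`, i.e. `-Δ = 2dI - J` ((2.1): `Δ = J - 2dI`).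
[cite: Slade2017, §2.1.1 (display (2.1) and the Fourier integral (2.2) for -Δ_{x,y})] -/
theorem fracLaplacianZd_one (hd : 1 ≤ d) (x y : Site d) :
    fracLaplacianZd d 1 x y = 2 * d * (srwLaw d 0 (x - y) - srwLaw d 1 (x - y)) := by
  have hπ : ((2 * π) ^ d : ℝ) ≠ 0 := by positivity
  unfold fracLaplacianZd
  simp_rw [Real.rpow_one, sum_mul_sub_eq_phase, laplaceSymbol_eq_avgCos hd]
  have hpt : ∀ k : Fin d → ℝ, 2 * d * (1 - avgCos d k) * Real.cos (phase k (x - y)) =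
      2 * d * (avgCos d k ^ 0 * Real.cos (phase k (x - y))) -
        2 * d * (avgCos d k ^ 1 * Real.cos (phase k (x - y))) := by
    intro k
    ring
  simp_rw [hpt]
  have hi : ∀ n, Integrable (fun k => avgCos d k ^ n * Real.cos (phase k (x - y)))
      ((volume : Measure (Fin d → ℝ)).restrict (brillouin d)) := fun n =>
    integrableOn_brillouin_of_continuous
      ((continuous_avgCos.pow n).mul (Real.continuous_cos.comp (continuous_phase _)))
  rw [integral_sub ((hi 0).const_mul _) ((hi 1).const_mul _), integral_const_mul,
    integral_const_mul, setIntegral_avgCos_pow_mul_cos hd 0, setIntegral_avgCos_pow_mul_cos hd 1]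
  field_simp

/-- Rows of `-Δ` are absolutely summable (indeed finitely supported). [folklore] -/
theorem summable_abs_fracLaplacianZd_one (hd : 1 ≤ d) (x : Site d) :
    Summable fun y => |fracLaplacianZd d 1 x y| := by
  have hd' : (0 : ℝ) < d := by exact_mod_cast hd
  have hsh : ∀ n, Summable fun y : Site d => srwLaw d n (x - y) := by
    intro n
    have h := ((Equiv.subLeft x).summable_iff (f := srwLaw d n)).2 (hasSum_srwLaw hd n).summable
    refine h.congr fun y => ?_
    simp only [Function.comp_apply, Equiv.subLeft_apply]
  have hs : Summable fun y : Site d => 2 * d * (srwLaw d 0 (x - y) + srwLaw d 1 (x - y)) :=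
    ((hsh 0).add (hsh 1)).mul_left _
  refine Summable.of_nonneg_of_le (fun _ => abs_nonneg _) (fun y => ?_) hs
  rw [fracLaplacianZd_one hd, abs_mul, abs_of_nonneg (by positivity : (0 : ℝ) ≤ 2 * d)]
  refine mul_le_mul_of_nonneg_left ?_ (by positivity)
  have h0 := srwLaw_nonneg (d := d) 0 (x - y)
  have h1 := srwLaw_nonneg (d := d) 1 (x - y)
  calc |srwLaw d 0 (x - y) - srwLaw d 1 (x - y)|
        ≤ |srwLaw d 0 (x - y) - 0| + |0 - srwLaw d 1 (x - y)| := abs_sub_le _ _ _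
    _ = srwLaw d 0 (x - y) + srwLaw d 1 (x - y) := by
        rw [sub_zero, zero_sub, abs_neg, abs_of_nonneg h0, abs_of_nonneg h1]

/-- **The symbol of `-Δ` is `λ(k)`, for every `k`**: `Σ_y (-Δ)_{0,y} cos(k·y) = 2d(1 - μ(k)) = λ(k)`
(the inversion of (2.2), here a finite sum). [cite: Slade2017, §2.1.1 (displays (2.2)–(2.3))] -/
theorem hasSum_fracLaplacianZd_one_mul_cos (hd : 1 ≤ d) (k : Fin d → ℝ) :
    HasSum (fun y : Site d => fracLaplacianZd d 1 0 y * Real.cos (phase k y)) (laplaceSymbol k) := by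
  have h0 := hasSum_srwLaw_zero_sub_mul_cos hd k 0
  have h1 := hasSum_srwLaw_zero_sub_mul_cos hd k 1
  have h := (h0.sub h1).mul_left (2 * (d : ℝ))
  rw [pow_zero, pow_one, ← laplaceSymbol_eq_avgCos hd] at h
  refine h.congr_fun fun y => ?_
  rw [fracLaplacianZd_one hd]
  ring

/-! ### Even kernels: the Fourier multiplier lemma -/

/-- An even absolutely summable kernel has vanishing sine series: `Σ_w a(w) sin(k·w) = 0`.
[folklore] -/
theorem hasSum_mul_sin_of_even {a : Site d → ℝ} (ha : Summable fun w => |a w|)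
    (heven : ∀ w, a (-w) = a w) (k : Fin d → ℝ) :
    HasSum (fun w => a w * Real.sin (phase k w)) 0 := by
  have hs : Summable fun w => a w * Real.sin (phase k w) :=
    Summable.of_norm_bounded ha fun w => by
      rw [Real.norm_eq_abs, abs_mul]
      exact mul_le_of_le_one_right (abs_nonneg _) (Real.abs_sin_le_one _)
  have hneg : ∑' w, a w * Real.sin (phase k w) = -∑' w, a w * Real.sin (phase k w) := by
    conv_lhs => rw [← (Equiv.neg (Site d)).tsum_eq (fun w => a w * Real.sin (phase k w))]
    rw [← tsum_neg]
    refine tsum_congr fun w => ?_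
    simp only [Equiv.neg_apply, heven, phase_neg, Real.sin_neg]
    ring
  have h0 : ∑' w, a w * Real.sin (phase k w) = 0 := by linarith
  rw [← h0]
  exact hs.hasSum

/-- Translating an even kernel through a character: if `Σ_w a(w)cos(k·w) = σ` then
`Σ_y a(y-x) c cos(k·(y-z)) = σ c cos(k·(x-z))` (addition formula; the sine series vanishes).
[folklore] -/
theorem hasSum_transl_symbol {a : Site d → ℝ} (ha : Summable fun w => |a w|)
    (heven : ∀ w, a (-w) = a w) {k : Fin d → ℝ} {σk : ℝ}
    (hk : HasSum (fun w => a w * Real.cos (phase k w)) σk) (c : ℝ) (x z : Site d) :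
    HasSum (fun y => a (y - x) * (c * Real.cos (phase k (y - z))))
      (σk * c * Real.cos (phase k (x - z))) := by
  have hsin := hasSum_mul_sin_of_even ha heven k
  have h1 : HasSum (fun w => a w * (c * Real.cos (phase k (w + (x - z)))))
      (σk * c * Real.cos (phase k (x - z))) := by
    have h := (hk.mul_left (c * Real.cos (phase k (x - z)))).sub
      (hsin.mul_left (c * Real.sin (phase k (x - z))))
    have hv : c * Real.cos (phase k (x - z)) * σk - c * Real.sin (phase k (x - z)) * 0 =
        σk * c * Real.cos (phase k (x - z)) := by ring
    rw [hv] at h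
    refine h.congr_fun fun w => ?_
    have hadd : phase k (w + (x - z)) = phase k w + phase k (x - z) := by
      unfold phase
      rw [← Finset.sum_add_distrib]
      refine Finset.sum_congr rfl fun j _ => ?_
      rw [Pi.add_apply, Int.cast_add]
      ring
    rw [hadd, Real.cos_add]
    ring
  have h2 := ((Equiv.subRight x).hasSum_iff
    (f := fun w => a w * (c * Real.cos (phase k (w + (x - z)))))).2 h1
  refine h2.congr_fun fun y => ?_
  simp only [Function.comp_apply, Equiv.subRight_apply, sub_add_sub_cancel]

/-- **Fourier multiplier lemma on `ℤ^d`.** Let `a` be an even, absolutely summable kernel whose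
Fourier series `Σ_w a(w)cos(k·w)` converges to `σ(k)` for a.e. `k ∈ [-π,π]^d`, and let `g` be
continuous. Then the translation-invariant matrix `A_{x,y} = a(y-x)` acts on the Fourier integral
`F(y) = ∫_{[-π,π]^d} g(k)cos(k·(y-z))dk` as multiplication of `g` by the symbol:
`Σ_y A_{x,y}F(y) = ∫ σ(k)g(k)cos(k·(x-z))dk` (dominated convergence: `|a(y-x)| sup|g|` is a summable
majorant uniformly in `k`). [folklore] -/
theorem hasSum_kernel_mul_fourierIntegral {a : Site d → ℝ} (ha : Summable fun w => |a w|)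
    (heven : ∀ w, a (-w) = a w) {σ g : (Fin d → ℝ) → ℝ} (hg : Continuous g)
    (hsymb : ∀ᵐ k ∂((volume : Measure (Fin d → ℝ)).restrict (brillouin d)),
      HasSum (fun w => a w * Real.cos (phase k w)) (σ k)) (x z : Site d) :
    HasSum (fun y => a (y - x) * ∫ k in brillouin d, g k * Real.cos (phase k (y - z)))
      (∫ k in brillouin d, σ k * g k * Real.cos (phase k (x - z))) := by
  set μQ : Measure (Fin d → ℝ) := (volume : Measure (Fin d → ℝ)).restrict (brillouin d) with hμQ
  haveI : IsFiniteMeasure μQ :=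
    isFiniteMeasure_restrict.2 (isCompact_brillouin d).measure_lt_top.ne
  obtain ⟨G, hG⟩ : ∃ G, ∀ k ∈ brillouin d, ‖g k‖ ≤ G :=
    (isCompact_brillouin d).exists_bound_of_continuousOn hg.continuousOn
  have hax : Summable fun y => |a (y - x)| := by
    have h := ((Equiv.subRight x).summable_iff (f := fun w => |a w|)).2 ha
    refine h.congr fun y => ?_
    simp only [Function.comp_apply, Equiv.subRight_apply]
  set F : Site d → (Fin d → ℝ) → ℝ := fun y k => a (y - x) * (g k * Real.cos (phase k (y - z)))
    with hF
  have hDC : HasSum (fun y => ∫ k, F y k ∂μQ)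
      (∫ k, σ k * g k * Real.cos (phase k (x - z)) ∂μQ) := by
    refine hasSum_integral_of_dominated_convergence (bound := fun y _ => |a (y - x)| * G)
      (fun y => ?_) (fun y => ?_) ?_ ?_ ?_
    · exact (continuous_const.mul (hg.mul (Real.continuous_cos.comp
        (continuous_phase _)))).aestronglyMeasurable
    · rw [hμQ]
      filter_upwards [ae_restrict_mem (measurableSet_brillouin d)] with k hk
      simp only [hF]
      rw [Real.norm_eq_abs, abs_mul, abs_mul]
      have h1 : |g k| ≤ G := by simpa only [Real.norm_eq_abs] using hG k hk
      have hG0 : 0 ≤ G := le_trans (abs_nonneg _) h1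
      have h2 : |Real.cos (phase k (y - z))| ≤ 1 := Real.abs_cos_le_one _
      calc |a (y - x)| * (|g k| * |Real.cos (phase k (y - z))|) ≤ |a (y - x)| * (G * 1) :=
            mul_le_mul_of_nonneg_left (mul_le_mul h1 h2 (abs_nonneg _) hG0) (abs_nonneg _)
        _ = |a (y - x)| * G := by ring
    · exact Eventually.of_forall fun k => hax.mul_right G
    · exact integrable_const _
    · rw [hμQ]
      filter_upwards [hsymb] with k hk
      simp only [hF]
      exact hasSum_transl_symbol ha heven hk (g k) x z
  have hFy : ∀ y, ∫ k, F y k ∂μQ = a (y - x) * ∫ k, g k * Real.cos (phase k (y - z)) ∂μQ :=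
    fun y => integral_const_mul _ _
  simp_rw [hFy] at hDC
  exact hDC

/-- `cos(k·(x-z))` integrates to `(2π)^d δ_{x,z}` over the Brillouin zone. [folklore] -/
theorem setIntegral_cos_phase_sub (x z : Site d) :
    ∫ k in brillouin d, Real.cos (phase k (x - z)) = if x = z then (2 * π) ^ d else 0 := by
  rw [setIntegral_cos_phase (x - z)]
  by_cases h : x = z
  · subst h; simp
  · rw [if_neg (sub_ne_zero.2 h), if_neg h]

/-- **A symbol plus a mass inverts its Fourier kernel.** If the even summable kernel `a` has symbol
`σ ≥ 0` (a.e. Fourier series, `σ` continuous) and `m > 0`… more precisely `σ(k) + m > 0` for all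
`k`, then `T = A + mI` (`A_{x,y} = a(y-x)`) applied to the Fourier kernel
`R_{y,z} = (2π)^{-d}∫cos(k·(y-z))/(σ(k)+m)dk` gives the identity: `Σ_y T_{x,y}R_{y,z} = δ_{x,z}`.
This is the computation "Fourier transform diagonalises translation-invariant matrices" behind
"the resolvent … is given by (2.12)" / "(2.13)". [cite: Slade2017, §2.1.2 (displays (2.12)–(2.13))] -/
theorem hasSum_kernel_add_mass_mul_fourierResolvent {a : Site d → ℝ} (ha : Summable fun w => |a w|)
    (heven : ∀ w, a (-w) = a w) {σ : (Fin d → ℝ) → ℝ} (hσ : Continuous σ) {m : ℝ}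
    (hpos : ∀ k, 0 < σ k + m)
    (hsymb : ∀ᵐ k ∂((volume : Measure (Fin d → ℝ)).restrict (brillouin d)),
      HasSum (fun w => a w * Real.cos (phase k w)) (σ k)) (x z : Site d) :
    HasSum (fun y => (a (y - x) + m * if x = y then 1 else 0) *
        (((2 * π) ^ d : ℝ)⁻¹ * ∫ k in brillouin d, (σ k + m)⁻¹ * Real.cos (phase k (y - z))))
      (if x = z then 1 else 0) := by
  have hπ : ((2 * π) ^ d : ℝ) ≠ 0 := by positivity
  have hg : Continuous fun k => (σ k + m)⁻¹ :=
    (hσ.add continuous_const).inv₀ fun k => (hpos k).ne'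
  -- the `A`-part
  have hA := (hasSum_kernel_mul_fourierIntegral ha heven hg hsymb x z).mul_left
    (((2 * π) ^ d : ℝ)⁻¹)
  -- the mass part
  have hM : HasSum (fun y => (m * if x = y then (1 : ℝ) else 0) *
      (((2 * π) ^ d : ℝ)⁻¹ * ∫ k in brillouin d, (σ k + m)⁻¹ * Real.cos (phase k (y - z))))
      (m * (((2 * π) ^ d : ℝ)⁻¹ * ∫ k in brillouin d, (σ k + m)⁻¹ * Real.cos (phase k (x - z)))) := by
    have : (fun y => (m * if x = y then (1 : ℝ) else 0) *
        (((2 * π) ^ d : ℝ)⁻¹ * ∫ k in brillouin d, (σ k + m)⁻¹ * Real.cos (phase k (y - z)))) =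
        fun y => if y = x then
          m * (((2 * π) ^ d : ℝ)⁻¹ * ∫ k in brillouin d, (σ k + m)⁻¹ * Real.cos (phase k (x - z)))
          else 0 := by
      funext y
      by_cases h : y = x
      · subst h; simp
      · rw [if_neg h, if_neg (Ne.symm h), mul_zero, zero_mul]
    rw [this]
    exact hasSum_ite_eq x _
  have hsum := hA.add hM
  -- evaluate the total
  have hi : ∀ c : (Fin d → ℝ) → ℝ, Continuous c →
      Integrable (fun k => c k * Real.cos (phase k (x - z)))
        ((volume : Measure (Fin d → ℝ)).restrict (brillouin d)) := fun c hc =>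
    integrableOn_brillouin_of_continuous (hc.mul (Real.continuous_cos.comp (continuous_phase _)))
  have htot : ((2 * π) ^ d : ℝ)⁻¹ * (∫ k in brillouin d, σ k * (σ k + m)⁻¹ * Real.cos (phase k (x - z))) +
      m * (((2 * π) ^ d : ℝ)⁻¹ * ∫ k in brillouin d, (σ k + m)⁻¹ * Real.cos (phase k (x - z))) =
      if x = z then 1 else 0 := by
    have h1 := hi (fun k => σ k * (σ k + m)⁻¹) (hσ.mul hg)
    have h2 := hi (fun k => (σ k + m)⁻¹) hg
    rw [← mul_assoc m, mul_comm m, mul_assoc, ← integral_const_mul m, ← mul_add,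
      ← integral_add h1 (h2.const_mul m)]
    have hpt : ∀ k, σ k * (σ k + m)⁻¹ * Real.cos (phase k (x - z)) +
        m * ((σ k + m)⁻¹ * Real.cos (phase k (x - z))) = Real.cos (phase k (x - z)) := by
      intro k
      have := (hpos k).ne'
      field_simp
    simp_rw [hpt]
    rw [setIntegral_cos_phase_sub]
    split_ifs
    · exact inv_mul_cancel₀ hπ
    · exact mul_zero _
  rw [htot] at hsum
  refine hsum.congr_fun fun y => ?_
  ring

/-! ### Uniqueness of the bounded inverse -/

/-- **A two-sided bounded inverse is the only bounded right inverse** (on columns): if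
`ST = I` with `S_{x,·}` absolutely summable and the rows of `T` uniformly absolutely summable, and a
bounded vector `F` solves `TF = c` with `c` bounded, then `F_x = Σ_y S_{x,y}c_y` — the rearrangement
`S(TF) = (ST)F` being absolutely convergent. [folklore] -/
theorem hasSum_inverse_mul_of_mul_eq {T S : Site d → Site d → ℝ} {x : Site d}
    (hTrow : ∀ y, Summable fun w => |T y w|) {A : ℝ} (hTA : ∀ y, ∑' w, |T y w| ≤ A)
    (hSrow : Summable fun y => |S x y|)
    (hST : ∀ w, HasSum (fun y => S x y * T y w) (if x = w then 1 else 0))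
    {F : Site d → ℝ} {B : ℝ} (hFB : ∀ w, |F w| ≤ B) {c : Site d → ℝ} {B' : ℝ}
    (hcB : ∀ y, |c y| ≤ B') (hTF : ∀ y, HasSum (fun w => T y w * F w) (c y)) :
    HasSum (fun y => S x y * c y) (F x) := by
  have hB0 : 0 ≤ B := le_trans (abs_nonneg _) (hFB x)
  set g : Site d → Site d → ℝ := fun y w => S x y * T y w * F w with hg
  set f : Site d → Site d → ℝ := fun y w => |S x y| * (|T y w| * B) with hf
  have hfg : ∀ y w, |g y w| ≤ f y w := by
    intro y w
    simp only [hg, hf]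
    rw [abs_mul, abs_mul, mul_assoc]
    exact mul_le_mul_of_nonneg_left (mul_le_mul_of_nonneg_left (hFB w) (abs_nonneg _))
      (abs_nonneg _)
  have hfrow : ∀ y, HasSum (f y) (|S x y| * ((∑' w, |T y w|) * B)) := fun y =>
    ((hTrow y).hasSum.mul_right B).mul_left _
  have hftot : Summable fun y => |S x y| * ((∑' w, |T y w|) * B) :=
    Summable.of_nonneg_of_le (fun y => by positivity)
      (fun y => mul_le_mul_of_nonneg_left (mul_le_mul_of_nonneg_right (hTA y) hB0) (abs_nonneg _))
      (hSrow.mul_right (A * B))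
  have hgrow : ∀ y, HasSum (g y) (S x y * c y) := by
    intro y
    refine ((hTF y).mul_left (S x y)).congr_fun fun w => ?_
    simp only [hg]
    ring
  have hbtot : Summable fun y => S x y * c y :=
    Summable.of_norm_bounded (hSrow.mul_right B') fun y => by
      rw [Real.norm_eq_abs, abs_mul]
      exact mul_le_mul_of_nonneg_left (hcB y) (abs_nonneg _)
  obtain ⟨-, hswap⟩ := hasSum_swap_of_abs_le hfg hfrow hftot.hasSum hgrow hbtot.hasSum
  have hcol : ∀ w, ∑' y, g y w = (if x = w then 1 else 0) * F w := by
    intro w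
    simp only [hg]
    rw [tsum_mul_right, (hST w).tsum_eq]
  simp_rw [hcol] at hswap
  have hF : HasSum (fun w => (if x = w then (1 : ℝ) else 0) * F w) (F x) := by
    have : (fun w => (if x = w then (1 : ℝ) else 0) * F w) = fun w => if w = x then F x else 0 := by
      funext w
      by_cases h : w = x
      · subst h; simp
      · rw [if_neg h, if_neg (Ne.symm h), zero_mul]
    rw [this]
    exact hasSum_ite_eq x (F x)
  exact hswap.unique hF ▸ hbtot.hasSum

/-! ### The kernels (2.12)–(2.13) in multiplier form -/

/-- (2.12) with the phase written as `k·(x-y)`: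
`(-Δ+s)⁻¹_{x,y} = (2π)^{-d}∫(λ(k)+s)⁻¹cos(k·(x-y))dk`. [cite: Slade2017, §2.1.2 (display (2.12))] -/
theorem resolventZd_eq_integral (s : ℝ) (x y : Site d) :
    resolventZd d s x y = ((2 * π) ^ d : ℝ)⁻¹ *
      ∫ k in brillouin d, (laplaceSymbol k + s)⁻¹ * Real.cos (phase k (x - y)) := by
  unfold resolventZd
  congr 1
  refine integral_congr_ae (Eventually.of_forall fun k => ?_)
  simp only
  rw [sum_mul_sub_eq_phase, div_eq_inv_mul]

/-- (2.13) with the phase written as `k·(x-y)`: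
`((-Δ)^β+m²)⁻¹_{x,y} = (2π)^{-d}∫(λ(k)^β+m²)⁻¹cos(k·(x-y))dk`. [cite: Slade2017, §2.1.2 (display (2.13))] -/
theorem fracResolventFourier_eq_integral (β m2 : ℝ) (x y : Site d) :
    fracResolventFourier d β m2 x y = ((2 * π) ^ d : ℝ)⁻¹ *
      ∫ k in brillouin d, (laplaceSymbol k ^ β + m2)⁻¹ * Real.cos (phase k (x - y)) := by
  unfold fracResolventFourier
  congr 1
  refine integral_congr_ae (Eventually.of_forall fun k => ?_)
  simp only
  rw [sum_mul_sub_eq_phase, div_eq_inv_mul]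

/-- `((-Δ)^β)_{0,-w} = ((-Δ)^β)_{0,w}`. [folklore] -/
theorem fracLaplacianZd_zero_neg (β : ℝ) (w : Site d) :
    fracLaplacianZd d β 0 (-w) = fracLaplacianZd d β 0 w := by
  rw [fracLaplacianZd_comm d β 0 (-w), transInv_apply (fracLaplacianZd_add d β) (-w) 0]
  simp

/-! ### (2.13) is the inverse matrix of `(-Δ)^β + m²` -/

/-- **`((-Δ)^β + m²)` applied to the Fourier kernel (2.13) is the identity**:
`Σ_y (((-Δ)^β)_{x,y} + m²δ_{x,y}) · (2π)^{-d}∫cos(k·(y-z))/(λ(k)^β+m²)dk = δ_{x,z}` (`d ≥ 1`,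
`0 < β < 1`, `m² > 0`), the series converging absolutely — the multiplier lemma with the a.e.
symbol `λ^β` of `(-Δ)^β`. [cite: Slade2017, §2.1.2 ("The resolvent of (-Δ)^β is (2.13)")] -/
theorem hasSum_fracLaplacianZd_add_mass_mul_fourier (hd : 1 ≤ d) {β : ℝ} (hβ0 : 0 < β)
    (hβ1 : β < 1) {m2 : ℝ} (hm2 : 0 < m2) (x z : Site d) :
    HasSum (fun y => (fracLaplacianZd d β x y + m2 * if x = y then 1 else 0) *
      fracResolventFourier d β m2 y z) (if x = z then 1 else 0) := by
  have ha : Summable fun w => |fracLaplacianZd d β 0 w| := summable_abs_fracLaplacianZd hd hβ0 hβ1 0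
  have hσ : Continuous fun k : Fin d → ℝ => laplaceSymbol k ^ β :=
    (continuous_const.mul (continuous_dispersion d)).rpow_const fun _ => Or.inr hβ0.le
  have hpos : ∀ k : Fin d → ℝ, 0 < laplaceSymbol k ^ β + m2 := fun k =>
    add_pos_of_nonneg_of_pos (Real.rpow_nonneg (laplaceSymbol_nonneg k) β) hm2
  have hsymb : ∀ᵐ k ∂((volume : Measure (Fin d → ℝ)).restrict (brillouin d)),
      HasSum (fun w => fracLaplacianZd d β 0 w * Real.cos (phase k w)) (laplaceSymbol k ^ β) := by
    filter_upwards [abs_avgCos_lt_one_ae hd] with k hk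
    exact hasSum_fracLaplacianZd_mul_cos hd hβ0 hβ1 hk
  have h := hasSum_kernel_add_mass_mul_fourierResolvent ha (fracLaplacianZd_zero_neg β) hσ hpos
    hsymb x z
  refine h.congr_fun fun y => ?_
  rw [fracResolventFourier_eq_integral, ← transInv_apply (fracLaplacianZd_add d β) x y]

/-- The Fourier kernel (2.13) is bounded: `|((-Δ)^β+m²)⁻¹_{y,z}| ≤ (2π)^{-d}∫(λ^β+m²)⁻¹dk`.
[folklore] -/
theorem abs_fracResolventFourier_le {β : ℝ} (hβ0 : 0 < β) {m2 : ℝ} (hm2 : 0 < m2) (y z : Site d) :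
    |fracResolventFourier d β m2 y z| ≤
      ((2 * π) ^ d : ℝ)⁻¹ * ∫ k in brillouin d, (laplaceSymbol k ^ β + m2)⁻¹ := by
  have hπ : (0 : ℝ) < ((2 * π) ^ d : ℝ)⁻¹ := by positivity
  have hpos : ∀ k : Fin d → ℝ, 0 < laplaceSymbol k ^ β + m2 := fun k =>
    add_pos_of_nonneg_of_pos (Real.rpow_nonneg (laplaceSymbol_nonneg k) β) hm2
  have hg : Continuous fun k : Fin d → ℝ => (laplaceSymbol k ^ β + m2)⁻¹ :=
    (((continuous_const.mul (continuous_dispersion d)).rpow_const fun _ => Or.inr hβ0.le).add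
      continuous_const).inv₀ fun k => (hpos k).ne'
  rw [fracResolventFourier_eq_integral, abs_mul, abs_of_pos hπ]
  refine mul_le_mul_of_nonneg_left ?_ hπ.le
  have h := norm_integral_le_of_norm_le (μ := (volume : Measure (Fin d → ℝ)).restrict (brillouin d))
    (f := fun k => (laplaceSymbol k ^ β + m2)⁻¹ * Real.cos (phase k (y - z)))
    (integrableOn_brillouin_of_continuous hg) (Eventually.of_forall fun k => by
      rw [Real.norm_eq_abs, abs_mul, abs_of_nonneg (inv_nonneg.2 (hpos k).le)]
      exact mul_le_of_le_one_right (inv_nonneg.2 (hpos k).le) (Real.abs_cos_le_one _))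
  rwa [Real.norm_eq_abs] at h

/-- **The Fourier integral (2.13) IS the resolvent `((-Δ)^β + m²)⁻¹` of `ℤ^d`** (`d ≥ 1`,
`0 < β < 1`, `m² > 0`): the kernel `(2π)^{-d}∫e^{ik·(x-y)}/(λ(k)^β+m²)dk` by which §2.1.2 *defines*
"the resolvent of `(-Δ)^β`" coincides with the inverse matrix `ℓ^∞(ℤ^d) → ℓ^∞(ℤ^d)` of
`(-Δ)^β + m²` constructed by the Neumann series of the jump chain
(`fracResolventZd`, `RigorousRGSmallParameterTorusResolvent`): both are bounded right inverses and
the bounded inverse is unique. Consequently every statement proved for `fracResolventZd`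
(positivity of all entries, row sums `1/m²`, the torus formula (2.19)) holds for (2.13), and
Proposition 2.1.3 holds for the operator kernel. [cite: Slade2017, §2.1.2 (display (2.13))] -/
theorem fracResolventFourier_eq_fracResolventZd (hd : 1 ≤ d) {β : ℝ} (hβ0 : 0 < β) (hβ1 : β < 1)
    {m2 : ℝ} (hm2 : 0 < m2) (x z : Site d) :
    fracResolventFourier d β m2 x z = fracResolventZd d β m2 x z := by
  set T : Site d → Site d → ℝ := fun a b => fracLaplacianZd d β a b + m2 * if a = b then 1 else 0
    with hT
  have hTinv : ∀ a b v, T (a + v) (b + v) = T a b := by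
    intro a b v
    simp only [hT, fracLaplacianZd_add]
    by_cases h : a = b
    · subst h; simp
    · rw [if_neg h, if_neg fun h' => h (add_right_cancel h')]
  have hTrow0 : Summable fun y => |T 0 y| := by
    have h1 : Summable fun y => |fracLaplacianZd d β 0 y| := summable_abs_fracLaplacianZd hd hβ0 hβ1 0
    have h2 : Summable fun y : Site d => |m2 * if (0 : Site d) = y then (1 : ℝ) else 0| := by
      refine (hasSum_ite_eq (0 : Site d) |m2|).summable.congr fun w => ?_
      by_cases h : w = 0
      · subst h; simp
      · rw [if_neg h, if_neg (Ne.symm h), mul_zero, abs_zero]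
    refine Summable.of_nonneg_of_le (fun y => abs_nonneg _) (fun y => ?_) (h1.add h2)
    simp only [hT]
    exact abs_add_le _ _
  have hTrow : ∀ y, Summable (fun w => |T y w|) ∧ ∑' w, |T y w| = ∑' w, |T 0 w| :=
    fun y => transInv_row_summable hTinv hTrow0 y
  have hSrow := (summable_abs_fracResolventZd hd hβ0 hβ1 hm2 x).1
  have hST : ∀ w, HasSum (fun y => fracResolventZd d β m2 x y * T y w) (if x = w then 1 else 0) :=
    fun w => hasSum_resolvent_mul_fracLaplacianZd hd hβ0 hβ1 hm2 x w
  have hFB := fun w => abs_fracResolventFourier_le (d := d) hβ0 hm2 w z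
  have hTF : ∀ y, HasSum (fun w => T y w * fracResolventFourier d β m2 w z)
      (if y = z then 1 else 0) :=
    fun y => hasSum_fracLaplacianZd_add_mass_mul_fourier hd hβ0 hβ1 hm2 y z
  have hcB : ∀ y, |(if y = z then (1 : ℝ) else 0)| ≤ 1 := fun y => by
    split_ifs <;> simp
  have h := hasSum_inverse_mul_of_mul_eq (fun y => (hTrow y).1) (fun y => (hTrow y).2.le) hSrow
    hST hFB hcB hTF
  have h' : HasSum (fun y => fracResolventZd d β m2 x y * if y = z then (1 : ℝ) else 0)
      (fracResolventZd d β m2 x z) := by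
    have : (fun y => fracResolventZd d β m2 x y * if y = z then (1 : ℝ) else 0) =
        fun y => if y = z then fracResolventZd d β m2 x z else 0 := by
      funext y
      split_ifs with hy
      · subst hy; ring
      · ring
    rw [this]
    exact hasSum_ite_eq z _
  exact h.unique h'

/-! ### (2.12) is the resolvent `(-Δ + s)⁻¹`: random-walk representation, positivity, row sums -/

/-- **Random-walk representation of the Fourier kernel (2.12)**: for `s > 0`,
`(-Δ+s)⁻¹_{x,y} = Σ_n (2d)ⁿ/(2d+s)ⁿ⁺¹ pₙ(x-y)` — expand `1/(λ(k)+s) = 1/((2d+s) - 2dμ(k))` in the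
geometric series (uniformly convergent, ratio `2d/(2d+s) < 1`) and integrate term by term with
`(2π)^{-d}∫μⁿcos(k·x)dk = pₙ(x)`. This is the "random walk representation" invoked in Remark
10.1.2 ("for large `m²` the dominant contribution to `Γ_{0,x}(s)` will arise from the shortest
possible walk, which has weight `O(1+s)^{-‖x‖₁}`"). [cite: Slade2017, §2.1.2 (display (2.12)) and Remark 10.1.2] -/
theorem hasSum_resolventZd_series (hd : 1 ≤ d) {s : ℝ} (hs : 0 < s) (x y : Site d) :
    HasSum (fun n : ℕ => (2 * d : ℝ) ^ n / (2 * d + s) ^ (n + 1) * srwLaw d n (x - y))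
      (resolventZd d s x y) := by
  have hd' : (0 : ℝ) < d := by exact_mod_cast hd
  have hD : (0 : ℝ) < 2 * d + s := by positivity
  set μQ : Measure (Fin d → ℝ) := (volume : Measure (Fin d → ℝ)).restrict (brillouin d) with hμQ
  haveI : IsFiniteMeasure μQ :=
    isFiniteMeasure_restrict.2 (isCompact_brillouin d).measure_lt_top.ne
  set r : ℝ := 2 * d / (2 * d + s) with hr
  have hr0 : 0 ≤ r := by positivity
  have hr1 : r < 1 := by rw [hr, div_lt_one hD]; linarith
  have hcoef : ∀ n : ℕ, (2 * d : ℝ) ^ n / (2 * d + s) ^ (n + 1) = (2 * d + s)⁻¹ * r ^ n := by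
    intro n
    rw [hr, div_pow, pow_succ]
    field_simp
  set F : ℕ → (Fin d → ℝ) → ℝ := fun n k =>
    (2 * d : ℝ) ^ n / (2 * d + s) ^ (n + 1) * (avgCos d k ^ n * Real.cos (phase k (x - y))) with hF
  set f : (Fin d → ℝ) → ℝ := fun k => (laplaceSymbol k + s)⁻¹ * Real.cos (phase k (x - y)) with hf
  have hDC : HasSum (fun n => ∫ k, F n k ∂μQ) (∫ k, f k ∂μQ) := by
    refine hasSum_integral_of_dominated_convergence (bound := fun n _ => (2 * d + s)⁻¹ * r ^ n)
      (fun n => ?_) (fun n => ?_) ?_ ?_ ?_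
    · exact (continuous_const.mul ((continuous_avgCos.pow n).mul
        (Real.continuous_cos.comp (continuous_phase _)))).aestronglyMeasurable
    · refine Eventually.of_forall fun k => ?_
      simp only [hF]
      rw [hcoef n, Real.norm_eq_abs, abs_mul,
        abs_of_nonneg (by positivity : (0 : ℝ) ≤ (2 * d + s)⁻¹ * r ^ n), abs_mul, abs_pow]
      have h1 : |avgCos d k| ^ n ≤ 1 := pow_le_one₀ (abs_nonneg _) (abs_avgCos_le_one k)
      have h2 : |Real.cos (phase k (x - y))| ≤ 1 := Real.abs_cos_le_one _
      calc (2 * d + s)⁻¹ * r ^ n * (|avgCos d k| ^ n * |Real.cos (phase k (x - y))|)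
          ≤ (2 * d + s)⁻¹ * r ^ n * (1 * 1) :=
            mul_le_mul_of_nonneg_left (mul_le_mul h1 h2 (abs_nonneg _) zero_le_one)
              (by positivity)
        _ = (2 * d + s)⁻¹ * r ^ n := by ring
    · exact Eventually.of_forall fun k => (summable_geometric_of_lt_one hr0 hr1).mul_left _
    · exact integrable_const _
    · refine Eventually.of_forall fun k => ?_
      have hμ1 : |r * avgCos d k| < 1 := by
        rw [abs_mul, abs_of_nonneg hr0]
        exact lt_of_le_of_lt (mul_le_of_le_one_right hr0 (abs_avgCos_le_one k)) hr1
      have hgeo := hasSum_geometric_of_abs_lt_one hμ1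
      have hden : (1 : ℝ) - r * avgCos d k ≠ 0 := by
        have := (abs_lt.1 hμ1).2
        linarith
      have hval : (2 * d + s)⁻¹ * (1 - r * avgCos d k)⁻¹ = (laplaceSymbol k + s)⁻¹ := by
        rw [← mul_inv, laplaceSymbol_eq_avgCos hd]
        congr 1
        rw [hr]
        field_simp
        ring
      have h := (hgeo.mul_left ((2 * d + s)⁻¹)).mul_right (Real.cos (phase k (x - y)))
      rw [hval] at h
      refine h.congr_fun fun n => ?_
      simp only [hF]
      rw [hcoef n, mul_pow]
      ring
  have hFn : ∀ n, ∫ k, F n k ∂μQ =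
      (2 * d : ℝ) ^ n / (2 * d + s) ^ (n + 1) * ((2 * π) ^ d * srwLaw d n (x - y)) := by
    intro n
    simp only [hF, hμQ]
    rw [integral_const_mul, setIntegral_avgCos_pow_mul_cos hd n (x - y)]
  simp_rw [hFn] at hDC
  rw [resolventZd_eq_integral]
  have hπ : ((2 * π) ^ d : ℝ) ≠ 0 := by positivity
  have h := hDC.mul_left (((2 * π) ^ d : ℝ)⁻¹)
  refine h.congr_fun fun n => ?_
  field_simp

/-- `(-Δ+s)⁻¹_{x,y} ≥ 0` (`s > 0`). [cite: Slade2017, §2.1.2 (display (2.12))] -/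
theorem resolventZd_nonneg (hd : 1 ≤ d) {s : ℝ} (hs : 0 < s) (x y : Site d) :
    0 ≤ resolventZd d s x y := by
  have hd' : (0 : ℝ) < d := by exact_mod_cast hd
  exact (hasSum_resolventZd_series hd hs x y).nonneg fun n =>
    mul_nonneg (by positivity) (srwLaw_nonneg _ _)

/-- **Row sums of the Laplacian resolvent: `Σ_y (-Δ+s)⁻¹_{x,y} = 1/s`**, i.e.
"`(-Δ+s)⁻¹𝟙 = s⁻¹𝟙`", the middle equality of (2.14) (`Σ_y pₙ = 1` and
`Σ_n (2d)ⁿ/(2d+s)ⁿ⁺¹ = 1/s`). [cite: Slade2017, §2.1.2 (display (2.14), middle equality)] -/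
theorem hasSum_resolventZd_row (hd : 1 ≤ d) {s : ℝ} (hs : 0 < s) (x : Site d) :
    HasSum (fun y => resolventZd d s x y) (1 / s) := by
  have hd' : (0 : ℝ) < d := by exact_mod_cast hd
  have hD : (0 : ℝ) < 2 * d + s := by positivity
  set c : ℕ → ℝ := fun n => (2 * d : ℝ) ^ n / (2 * d + s) ^ (n + 1) with hc
  have hc0 : ∀ n, 0 ≤ c n := fun n => by positivity
  have hrow : ∀ n, HasSum (fun y : Site d => c n * srwLaw d n (x - y)) (c n) := by
    intro n
    have h := ((Equiv.subLeft x).hasSum_iff (f := srwLaw d n)).2 (hasSum_srwLaw hd n)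
    have h' : HasSum (fun y : Site d => srwLaw d n (x - y)) 1 :=
      h.congr_fun fun y => by simp only [Function.comp_apply, Equiv.subLeft_apply]
    simpa only [mul_one] using h'.mul_left (c n)
  have htot : HasSum c (1 / s) := by
    set r : ℝ := 2 * d / (2 * d + s) with hr
    have hr0 : 0 ≤ r := by positivity
    have hr1 : r < 1 := by rw [hr, div_lt_one hD]; linarith
    have h := (hasSum_geometric_of_lt_one hr0 hr1).mul_left ((2 * d + s)⁻¹)
    have h1r : 1 - r = s / (2 * d + s) := by
      rw [hr, eq_div_iff hD.ne', sub_mul, div_mul_cancel₀ _ hD.ne', one_mul]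
      ring
    have hval : (2 * d + s)⁻¹ * (1 - r)⁻¹ = 1 / s := by
      rw [h1r, inv_div, inv_mul_eq_div, div_div_cancel_left' hD.ne', one_div]
    rw [hval] at h
    refine h.congr_fun fun n => ?_
    simp only [hc, hr]
    rw [div_pow, pow_succ]
    field_simp
  obtain ⟨-, hswap⟩ := hasSum_swap_of_nonneg (f := fun n y => c n * srwLaw d n (x - y))
    (fun n y => mul_nonneg (hc0 n) (srwLaw_nonneg _ _)) hrow htot
  refine hswap.congr_fun fun y => ?_
  exact ((hasSum_resolventZd_series hd hs x y).tsum_eq).symm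

/-- Rows of `(-Δ+s)⁻¹` are absolutely summable with `ℓ¹` norm `1/s`. [cite: Slade2017, §2.1.2] -/
theorem summable_abs_resolventZd (hd : 1 ≤ d) {s : ℝ} (hs : 0 < s) (x : Site d) :
    Summable (fun y => |resolventZd d s x y|) ∧ ∑' y, |resolventZd d s x y| = 1 / s := by
  have h := hasSum_resolventZd_row hd hs x
  have he : (fun y => |resolventZd d s x y|) = fun y => resolventZd d s x y :=
    funext fun y => abs_of_nonneg (resolventZd_nonneg hd hs x y)
  rw [he]
  exact ⟨h.summable, h.tsum_eq⟩

/-- Entries of `(-Δ+s)⁻¹` are at most `1/s`. [folklore] -/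
theorem resolventZd_le (hd : 1 ≤ d) {s : ℝ} (hs : 0 < s) (x y : Site d) :
    resolventZd d s x y ≤ 1 / s :=
  le_hasSum (hasSum_resolventZd_row hd hs x) y fun w _ => resolventZd_nonneg hd hs x w

/-- **`(-Δ + s)` applied to (2.12) is the identity**: `Σ_y (-Δ_{x,y} + sδ_{x,y})(-Δ+s)⁻¹_{y,z} =
δ_{x,z}` (`d ≥ 1`, `s > 0`) — the multiplier lemma with the (everywhere) symbol `λ` of `-Δ`.
[cite: Slade2017, §2.1.2 ("the resolvent of -Δ is given by (2.12)")] -/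
theorem hasSum_laplacianZd_add_mass_mul_resolvent (hd : 1 ≤ d) {s : ℝ} (hs : 0 < s) (x z : Site d) :
    HasSum (fun y => (fracLaplacianZd d 1 x y + s * if x = y then 1 else 0) * resolventZd d s y z)
      (if x = z then 1 else 0) := by
  have ha := summable_abs_fracLaplacianZd_one hd 0
  have hσ : Continuous (laplaceSymbol : (Fin d → ℝ) → ℝ) :=
    continuous_const.mul (continuous_dispersion d)
  have hpos : ∀ k : Fin d → ℝ, 0 < laplaceSymbol k + s := fun k =>
    add_pos_of_nonneg_of_pos (laplaceSymbol_nonneg k) hs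
  have h := hasSum_kernel_add_mass_mul_fourierResolvent ha (fracLaplacianZd_zero_neg 1) hσ hpos
    (Eventually.of_forall fun k => hasSum_fracLaplacianZd_one_mul_cos hd k) x z
  refine h.congr_fun fun y => ?_
  rw [resolventZd_eq_integral, ← transInv_apply (fracLaplacianZd_add d 1) x y]

/-- **(2.12) applied to `(-Δ + s)` is the identity** (by the symmetry of both factors).
[cite: Slade2017, §2.1.2 (display (2.12))] -/
theorem hasSum_resolvent_mul_laplacianZd_add_mass (hd : 1 ≤ d) {s : ℝ} (hs : 0 < s) (x z : Site d) :
    HasSum (fun y => resolventZd d s x y * (fracLaplacianZd d 1 y z + s * if y = z then 1 else 0))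
      (if x = z then 1 else 0) := by
  have h := hasSum_laplacianZd_add_mass_mul_resolvent hd hs z x
  have e : (if z = x then (1 : ℝ) else 0) = if x = z then 1 else 0 := by
    by_cases hxz : x = z
    · subst hxz; rfl
    · rw [if_neg hxz, if_neg (Ne.symm hxz)]
  rw [e] at h
  refine h.congr_fun fun y => ?_
  rw [resolventZd_comm d s x y, fracLaplacianZd_comm d 1 y z, mul_comm]
  by_cases hyz : y = z
  · subst hyz; simp
  · rw [if_neg hyz, if_neg (Ne.symm hyz)]

/-! ### The torus: `(-Δ_Λ + s)⁻¹` is the periodised (2.12) (display (3.2)) -/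

/-- `-Δ + s` on `ℤ^d` periodises to `-Δ_Λ + s` on the torus (with `-Δ_Λ` the periodised
Laplacian (2.18), `fracLaplacianTorus d 1 M`). [cite: Slade2017, §2.2.2 (display (2.18))] -/
theorem periodise_laplacianZd_add_mass (hd : 1 ≤ d) {M : ℕ} [NeZero M] (s : ℝ)
    (x y : TorusSite d M) :
    periodise M (fun a b => fracLaplacianZd d 1 a b + s * if a = b then 1 else 0) x y =
      covInvMatrix d 1 M s x y := by
  have h1 : Summable fun w => fracLaplacianZd d 1 (fun j => ((x j).val : ℤ)) w :=
    (summable_abs_fracLaplacianZd_one hd _).of_abs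
  have h2 : Summable fun w : Site d =>
      s * if (fun j => ((x j).val : ℤ)) = w then (1 : ℝ) else 0 := by
    refine (hasSum_ite_eq (fun j => ((x j).val : ℤ)) s).summable.congr fun w => ?_
    by_cases h : w = (fun j => ((x j).val : ℤ))
    · subst h; simp
    · rw [if_neg h, if_neg (Ne.symm h), mul_zero]
  rw [periodise_add (fun a b => fracLaplacianZd d 1 a b) (fun a b => s * if a = b then (1 : ℝ) else 0)
      x y h1 h2,
    periodise_const_mul s (fun a b : Site d => if a = b then (1 : ℝ) else 0) x y, periodise_delta,
    covInvMatrix_apply, fracLaplacianTorus_eq_periodise]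
  by_cases hxy : x = y
  · rw [if_pos hxy, if_pos hxy, mul_one]
  · rw [if_neg hxy, if_neg hxy, mul_zero]

/-- **Slade, display (3.2), PROVED for the operator: the torus resolvent `(-Δ_Λ + s)⁻¹` is the
periodisation of `(-Δ_{ℤ^d} + s)⁻¹`**, "`(-Δ_Λ+s)⁻¹_{x,y} = Σ_{z∈ℤ^d}(-Δ_{ℤ^d}+s)⁻¹_{x,y+zL^N}`" —
here for any period `M ≥ 1` in place of `L^N`, `d ≥ 1`, `s > 0`, with `(-Δ_{ℤ^d}+s)⁻¹` the Fourier
kernel (2.12) (Lemma 2.2.2 applied with `T = -Δ + s`; in particular `-Δ_Λ + s` is invertible).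
[cite: Slade2017, §3.1 (display (3.2)) and Lemma 2.2.2] -/
theorem Slade2017_torusLaplaceResolvent (hd : 1 ≤ d) {M : ℕ} [NeZero M] {s : ℝ} (hs : 0 < s) :
    (covInvMatrix d 1 M s)⁻¹ = Matrix.of (periodise M (resolventZd d s)) := by
  set T : Site d → Site d → ℝ := fun a b => fracLaplacianZd d 1 a b + s * if a = b then 1 else 0
    with hT
  have hTinv : ∀ x y v, T (x + v) (y + v) = T x y := by
    intro x y v
    simp only [hT, fracLaplacianZd_add]
    by_cases h : x = y
    · subst h; simp
    · rw [if_neg h, if_neg fun h' => h (add_right_cancel h')]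
  have hTrow : Summable fun y => |T 0 y| := by
    have h1 : Summable fun y => |fracLaplacianZd d 1 0 y| := summable_abs_fracLaplacianZd_one hd 0
    have h2 : Summable fun y : Site d => |s * if (0 : Site d) = y then (1 : ℝ) else 0| := by
      refine (hasSum_ite_eq (0 : Site d) |s|).summable.congr fun w => ?_
      by_cases h : w = 0
      · subst h; simp
      · rw [if_neg h, if_neg (Ne.symm h), mul_zero, abs_zero]
    refine Summable.of_nonneg_of_le (fun y => abs_nonneg _) (fun y => ?_) (h1.add h2)
    simp only [hT]
    exact abs_add_le _ _
  obtain ⟨hSrow, hSB⟩ : (∀ x, Summable fun y => |resolventZd d s x y|) ∧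
      ∀ x, ∑' y, |resolventZd d s x y| ≤ 1 / s :=
    ⟨fun x => (summable_abs_resolventZd hd hs x).1, fun x => (summable_abs_resolventZd hd hs x).2.le⟩
  have hTS : ∀ x z, HasSum (fun y => T x y * resolventZd d s y z) (if x = z then 1 else 0) :=
    fun x z => hasSum_laplacianZd_add_mass_mul_resolvent hd hs x z
  have hST : ∀ x z, HasSum (fun y => resolventZd d s x y * T y z) (if x = z then 1 else 0) :=
    fun x z => hasSum_resolvent_mul_laplacianZd_add_mass hd hs x z
  obtain ⟨hmul, -⟩ := Slade2017_lem222 (M := M) T (resolventZd d s) hTinv hTrow hSrow hSB hTS hST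
  have hper : Matrix.of (periodise M T) = covInvMatrix d 1 M s := by
    ext x y
    simp only [Matrix.of_apply, hT]
    exact periodise_laplacianZd_add_mass hd s x y
  rw [hper] at hmul
  exact Matrix.inv_eq_right_inv hmul

/-! ### Proposition 2.1.3 and (2.14) for the operator kernels; (3.6) on the torus -/

/-- **Slade, Proposition 2.1.3 for the resolvent operators** (massive case): for `d ≥ 1`,
`0 < β < 1`, `m² > 0` and all `x, y ∈ ℤ^d`,
`((-Δ)^β+m²)⁻¹_{x,y} = ∫₀^∞ (-Δ+s)⁻¹_{x,y} ρ^{(β)}(s,m²) ds`, where now the left side is the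
inverse matrix of `(-Δ)^β + m²` on `ℓ^∞(ℤ^d)` (`fracResolventZd`) and `(-Δ+s)⁻¹` is the inverse
matrix of `-Δ + s` (`hasSum_laplacianZd_add_mass_mul_resolvent`): Proposition 2.1.3 as printed
(`Slade2017_prop213`, for the Fourier kernels) combined with the identification
`fracResolventFourier_eq_fracResolventZd`. [cite: Slade2017, Proposition 2.1.3] -/
theorem Slade2017_prop213_resolvent (hd : 1 ≤ d) {β : ℝ} (hβ0 : 0 < β) (hβ1 : β < 1) {m2 : ℝ}
    (hm2 : 0 < m2) (x y : Site d) :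
    fracResolventZd d β m2 x y =
      ∫ s in Ioi (0 : ℝ), resolventZd d s x y * Kato.katoDensity β m2 s := by
  rw [← fracResolventFourier_eq_fracResolventZd hd hβ0 hβ1 hm2, Slade2017_prop213 hβ0 hβ1 hm2]

/-- `∫₀^∞ s⁻¹ρ^{(β)}(s,m²)ds = m⁻²` — Lemma 2.1.2 at `t = 0`, the last equality of (2.14).
[cite: Slade2017, §2.1.2 (display (2.14), last equality) and Lemma 2.1.2] -/
theorem integral_inv_mul_katoDensity {β : ℝ} (hβ0 : 0 < β) (hβ1 : β < 1) {m2 : ℝ} (hm2 : 0 < m2) :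
    ∫ s in Ioi (0 : ℝ), s⁻¹ * Kato.katoDensity β m2 s = m2⁻¹ := by
  have h := Slade2017_lem212 hβ0 hβ1 (le_refl 0) hm2.le (Or.inr hm2)
  rw [Real.zero_rpow hβ0.ne', zero_add, one_div] at h
  rw [h]
  refine setIntegral_congr_fun measurableSet_Ioi fun s _ => ?_
  rw [add_zero, div_eq_inv_mul]

/-- **Slade, display (2.14), PROVED for the operators**: "`((-Δ)^β+m²)⁻¹𝟙 =
∫₀^∞(-Δ+s)⁻¹𝟙 ρ^{(β)}(s,m²)ds = ∫₀^∞ s⁻¹𝟙 ρ^{(β)}(s,m²)ds = m⁻²𝟙`": the row sums of the resolvent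
of `(-Δ)^β + m²` equal `∫₀^∞ s⁻¹ρ^{(β)}(s,m²)ds` (`= m⁻²`, `integral_inv_mul_katoDensity`; the
middle step is `hasSum_resolventZd_row`). [cite: Slade2017, §2.1.2 (display (2.14))] -/
theorem Slade2017_resolvent_rowSum (hd : 1 ≤ d) {β : ℝ} (hβ0 : 0 < β) (hβ1 : β < 1) {m2 : ℝ}
    (hm2 : 0 < m2) (x : Site d) :
    HasSum (fun y => fracResolventZd d β m2 x y)
      (∫ s in Ioi (0 : ℝ), s⁻¹ * Kato.katoDensity β m2 s) := by
  rw [integral_inv_mul_katoDensity hβ0 hβ1 hm2, ← one_div]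
  exact hasSum_fracResolventZd_row hd hβ0 hβ1 hm2 x

/-- **Slade, display (2.14) for the kernel (2.13) as printed**: `Σ_y ((-Δ)^β+m²)⁻¹_{x,y} = m⁻²`
with `((-Δ)^β+m²)⁻¹` the Fourier integral (2.13) (`d ≥ 1`, `0 < β < 1`, `m² > 0`).
[cite: Slade2017, §2.1.2 (display (2.14))] -/
theorem Slade2017_display214 (hd : 1 ≤ d) {β : ℝ} (hβ0 : 0 < β) (hβ1 : β < 1) {m2 : ℝ}
    (hm2 : 0 < m2) (x : Site d) :
    HasSum (fun y => fracResolventFourier d β m2 x y) m2⁻¹ := by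
  have h := hasSum_fracResolventZd_row hd hβ0 hβ1 hm2 x
  rw [one_div] at h
  exact h.congr_fun fun y => fracResolventFourier_eq_fracResolventZd hd hβ0 hβ1 hm2 x y

/-- **Slade, display (2.19) with the Fourier kernel (2.13), as printed**:
`((-Δ_Λ)^β+m²)⁻¹_{x,y} = Σ_{z∈ℤ^d}((-Δ_{ℤ^d})^β+m²)⁻¹_{x,y+zL^N}` with the right-hand side the
Fourier integrals (2.13) (any period `M ≥ 1` in place of `L^N`; `d ≥ 1`, `0 < β < 1`, `m² > 0`).
[cite: Slade2017, §2.2.3 (display (2.19))] -/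
theorem Slade2017_display219_fourier (hd : 1 ≤ d) {β : ℝ} (hβ0 : 0 < β) (hβ1 : β < 1)
    {M : ℕ} [NeZero M] {m2 : ℝ} (hm2 : 0 < m2) :
    (covInvMatrix d β M m2)⁻¹ = Matrix.of (periodise M (fracResolventFourier d β m2)) := by
  rw [Slade2017_torusResolvent hd hβ0 hβ1 hm2]
  congr 1
  funext x y
  unfold periodise
  exact tsum_congr fun z => (fracResolventFourier_eq_fracResolventZd hd hβ0 hβ1 hm2 _ _).symm

/-- `s ↦ (-Δ+s)⁻¹_{x,y}` is measurable (a parametric integral of a jointly measurable integrand).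
[folklore] -/
theorem measurable_resolventZd (x y : Site d) : Measurable fun s : ℝ => resolventZd d s x y := by
  unfold resolventZd
  refine Measurable.const_mul ?_ _
  have hF : StronglyMeasurable (Function.uncurry fun (s : ℝ) (k : Fin d → ℝ) =>
      Real.cos (∑ j, k j * ((x j : ℝ) - (y j : ℝ))) / (laplaceSymbol k + s)) := by
    refine Measurable.stronglyMeasurable (Measurable.div ?_ ?_)
    · have hc : Continuous fun k : Fin d → ℝ => Real.cos (∑ j, k j * ((x j : ℝ) - (y j : ℝ))) := by
        fun_prop
      exact hc.measurable.comp measurable_snd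
    · exact (((continuous_const.mul (continuous_dispersion d)).comp continuous_snd).add
        continuous_fst).measurable
  exact (hF.integral_prod_right (ν := (volume : Measure (Fin d → ℝ)).restrict (brillouin d))).measurable

/-- **Slade, display (3.6), PROVED: the covariance of the model as a Kato mixture of torus
Laplacian resolvents.** For `d ≥ 1`, `0 < β < 1` (`β = α/2`), `m² > 0` and any period `M ≥ 1`,
`C_{x,y} = ((-Δ_Λ)^β + m²)⁻¹_{x,y} = ∫₀^∞ (-Δ_Λ+s)⁻¹_{x,y} ρ^{(β)}(s,m²) ds`, with `C⁻¹` the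
matrix `covInvMatrix d β M m²` of the Gibbs weight and `(-Δ_Λ+s)⁻¹` the inverse matrix of the
torus Laplacian plus `s` (`covInvMatrix d 1 M s`). Printed derivation "(2.17)-Λ": periodise
Proposition 2.1.3 using (2.19) and (3.2); here the interchange of `Σ_{z∈ℤ^d}` and `∫₀^∞ds` is
justified by positivity of all terms (`integral_tsum`). This is the formula into which the
finite-range decomposition of `(-Δ_Λ+s)⁻¹` is inserted (§3.2). [cite: Slade2017, §3.2 (displays (3.5)–(3.6))] -/
theorem Slade2017_torusCovariance_katoMixture (hd : 1 ≤ d) {β : ℝ} (hβ0 : 0 < β) (hβ1 : β < 1)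
    {M : ℕ} [NeZero M] {m2 : ℝ} (hm2 : 0 < m2) (x y : TorusSite d M) :
    (covInvMatrix d β M m2)⁻¹ x y =
      ∫ s in Ioi (0 : ℝ), (covInvMatrix d 1 M s)⁻¹ x y * Kato.katoDensity β m2 s := by
  set xr : Site d := fun j => ((x j).val : ℤ) with hxr
  set yz : Site d → Site d := fun z j => ((y j).val : ℤ) + M * z j with hyz
  set f : Site d → ℝ → ℝ := fun z s => resolventZd d s xr (yz z) * Kato.katoDensity β m2 s with hf
  have hinj : Function.Injective yz := by
    intro z₁ z₂ h
    funext j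
    have hj := congr_fun h j
    simpa [hyz, NeZero.ne M] using hj
  have hL : (covInvMatrix d β M m2)⁻¹ x y = ∑' z, fracResolventZd d β m2 xr (yz z) := by
    rw [Slade2017_torusResolvent hd hβ0 hβ1 hm2, Matrix.of_apply]
    rfl
  have hterm : ∀ z, fracResolventZd d β m2 xr (yz z) = ∫ s in Ioi (0 : ℝ), f z s := fun z =>
    Slade2017_prop213_resolvent hd hβ0 hβ1 hm2 _ _
  have hmeas : ∀ z, AEStronglyMeasurable (f z) ((volume : Measure ℝ).restrict (Ioi 0)) := fun z =>
    ((measurable_resolventZd _ _).mul (Kato.measurable_katoDensity β m2)).aestronglyMeasurable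
  have hnn : ∀ z, ∀ s ∈ Ioi (0 : ℝ), 0 ≤ f z s := fun z s hs =>
    mul_nonneg (resolventZd_nonneg hd hs _ _) (Kato.katoDensity_pos hβ0 hβ1 m2 hs).le
  have hint : ∀ z, Integrable (f z) ((volume : Measure ℝ).restrict (Ioi 0)) := by
    intro z
    have hb : IntegrableOn (fun s : ℝ => s ^ ((0 : ℝ) - 1) * Kato.katoDensity β m2 s) (Ioi 0) :=
      Kato.integrableOn_rpow_mul_katoDensity hβ0 hβ1 hm2.ne' (by linarith) hβ0
    refine Integrable.mono' hb (hmeas z) ?_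
    filter_upwards [ae_restrict_mem measurableSet_Ioi] with s hs
    rw [Real.norm_eq_abs, abs_of_nonneg (hnn z s hs)]
    have h1 : resolventZd d s xr (yz z) ≤ 1 / s := resolventZd_le hd hs _ _
    have h2 : s ^ ((0 : ℝ) - 1) = 1 / s := by rw [zero_sub, Real.rpow_neg_one, one_div]
    rw [h2]
    exact mul_le_mul_of_nonneg_right h1 (Kato.katoDensity_pos hβ0 hβ1 m2 hs).le
  have hfin : ∑' z, ∫⁻ s in Ioi (0 : ℝ), ‖f z s‖ₑ ≠ ⊤ := by
    have he : ∀ z, ∫⁻ s in Ioi (0 : ℝ), ‖f z s‖ₑ = ENNReal.ofReal (fracResolventZd d β m2 xr (yz z)) := by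
      intro z
      rw [hterm z, ofReal_integral_eq_lintegral_ofReal (hint z)
        ((ae_restrict_mem measurableSet_Ioi).mono fun s hs => hnn z s hs)]
      exact setLIntegral_congr_fun measurableSet_Ioi fun s hs => Real.enorm_eq_ofReal (hnn z s hs)
    simp_rw [he]
    rw [← ENNReal.ofReal_tsum_of_nonneg (fun z => fracResolventZd_nonneg hd hβ0 hβ1 hm2 _ _)]
    · exact ENNReal.ofReal_ne_top
    · exact ((summable_abs_fracResolventZd hd hβ0 hβ1 hm2 xr).1.of_abs).comp_injective hinj
  have hswap := integral_tsum hmeas hfin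
  rw [hL]
  simp_rw [hterm]
  rw [← hswap]
  refine setIntegral_congr_fun measurableSet_Ioi fun s hs => ?_
  simp only [hf]
  rw [tsum_mul_right, Slade2017_torusLaplaceResolvent hd hs, Matrix.of_apply]
  rfl

end LongRangePhi4

end Literature.Barriers.CriticalPhenomena
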